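import Summits.QuantumFields.YangMills.Theorems.FluctuationComparisonRegPrIntLS2BetaResidualGauge
import Literature.MathematicalPhysics.QuantumFieldTheory.Balaban1983to89.TorusGeometry
import HarnessLib

/-!
# (RG-K) THE ℤ₂ SEAM TWIST, I — WORDS: a central involution on the WRAPPING bonds of one lattice direction (a 't Hooft flux insertion)
# multiplies the transport along a lattice word by `n1 ^ #seam-steps`; along every CLOSED word of zero net displacement it is invisible

Helper for crux `stmt-QuantumFields-20520` (`Theses.UnitScaleTilt.FluctuationComparisonRegPrIntL`), the (T)-chain of LINE
`semiclassical_s2beta` (cell `ym3-torus`, width seat «width 16» px16 g18).  The per-datum table of the (T)-chain is stratified by the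
stabiliser of the window datum `V`; its top stratum («all closed-walk holonomies central», ✓`exists_gauge_centralValued_of_loopHol_central`)
consists of the gauge transforms of the flat `ℤ₂`-connections.  The family's tori have EVEN period `2·L^{m+K−j}` (lit `Params.sitesPerDir`),
so a flat `ℤ₂`-connection is, up to a `±1`-valued gauge, a SEAM cochain (lit ✓`TorusChart.eq_d₀_prim_add_seam_wind`): `−1` exactly on the
wrapping bonds `x_μ = N − 1` of some directions — holonomy `−1` around those cycles, NOT a pure gauge.  This file and its sequel
(`…S2BetaSeamTwistDescent`) supply the symmetry carrying the flat datum to those sectors, one direction `μ` at a time.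

THE SEAM TWIST (central involution `n1`: `n1·g = g·n1`, `n1·n1 = 1`; `SU(2)`: `n1 = −1`), written INLINE (no definition):
`U ↦ fun b => (if b.dir = μ ∧ (b.src μ).val + 1 = P.sitesPerDir j then n1 else 1) * U b`.

* ★ `holT_seamTwist_count` — the twisted transport along a word is `n1 ^ #{steps of the walk on seam bonds}` times the untwisted one
  (centrality);
* ★ `seam_crossing_identity` — along any walk, `N·(#forward − #backward seam crossings) = netDisp_μ − (x_μ(end) − x_μ(start))`
  (exact bookkeeping of the canonical representative of the `μ`-coordinate, lit `Site.shift`/`Site.unshift`);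
* ★ `holT_seamTwist_of_closed` — along every CLOSED word of zero net displacement (every loop `Γ ∪ [x,x′] ∪ (−Γ′) ∪ (−c)` of (0.4), lit
  ✓`netDisp_loopWord`, ✓`walkEnd_loopWord`) the number of seam steps is EVEN and the twisted transport equals the untwisted one;
  `loopHol_seamTwist`, `corr_seamTwist` — the (0.4) weights `corr ℰ U c Γ` are twist-blind.

HONEST: lattice-word ∕ `ZMod` bookkeeping; nothing of Bałaban's analysis; a symmetry of the tree's OWN averaging (0.4); one direction at a
time; this file proves NO stub of the line — TUBE-REG∘, GAP♯∘, EXW∘, S2β and crux 20520 stay OPEN; rung R3 (YM₃ on T³) is NOT d = 4, NOT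
infinite volume, NOT a mass gap, NOT Clay; the Yang–Mills mass gap is NOT proved.
-/

set_option autoImplicit false

noncomputable section

open Set Function
open Literature.MathematicalPhysics.QuantumFieldTheory.Balaban1983to89
open Literature.MathematicalPhysics.QuantumFieldTheory.Balaban1983to89.T4Continuum
open Literature.MathematicalPhysics.QuantumFieldTheory.Balaban1983to89.AveragingRT
open Literature.MathematicalPhysics.QuantumFieldTheory.Balaban1983to89.BlockAveraging
open Literature.MathematicalPhysics.QuantumFieldTheory.Balaban1983to89.B10Eq27TorusAxialLog (holT holT_nil holT_cons_true holT_cons_false holT_eq_holAt)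
open Literature.MathematicalPhysics.QuantumFieldTheory.Balaban1983to89.T3ContinuumYM3Torus
open Literature.MathematicalPhysics.QuantumFieldTheory.Balaban1983to89.T3UnitScaleTilt
open Literature.MathematicalPhysics.QuantumFieldTheory.Balaban1983to89.T3TiltDescent
open Literature.MathematicalPhysics.QuantumFieldTheory.Balaban1983to89.T3LevelShift
open Literature.MathematicalPhysics.QuantumFieldTheory.Balaban1983to89.T3ConstrainedMinimiser (fibre)

namespace Summit.QuantumFields.YangMills.Theorems.FluctuationComparisonRegPrIntLS2BetaSeamTwistWords

/-! ## §1 Pattern twists along words; the seam-crossing identity; closed words -/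

section Words

variable {P : Params} {j : ℕ} {G : Type*} [GaugeGroup G]

/-- A central factor attached by a decidable condition is central. [folklore] -/
theorem ite_mul_comm' (n1 : G) (hc : ∀ g : G, n1 * g = g * n1) (p : Prop) [Decidable p] (g : G) :
    (if p then n1 else 1) * g = g * (if p then n1 else 1) := by
  split_ifs
  · exact hc g
  · rw [one_mul, mul_one]

/-- Natural powers of a central element are central. [folklore] -/
theorem pow_mul_comm (n1 : G) (hc : ∀ g : G, n1 * g = g * n1) (k : ℕ) (g : G) : n1 ^ k * g = g * n1 ^ k :=
  ((show Commute n1 g from hc g).pow_left k).eq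

/-- An involution is its own inverse. [folklore] -/
theorem inv_eq_self_of_sq (n1 : G) (hsq : n1 * n1 = 1) : n1⁻¹ = n1 :=
  inv_eq_of_mul_eq_one_right hsq

/-- For an involution, a power of even exponent is `1`. [folklore] -/
theorem pow_two_mul_eq_one (n1 : G) (hsq : n1 * n1 = 1) (k : ℕ) : n1 ^ (2 * k) = 1 := by
  rw [pow_mul, sq, hsq, one_pow]

/-- ★ **THE SEAM-TWISTED TRANSPORT ALONG A WORD** is `n1 ^ #{steps on seam bonds}` times the untwisted one (centrality and `n1⁻¹ = n1`).
[cite: Balaban1985Averaging, (9) p.19] -/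
theorem holT_seamTwist_count (n1 : G) (hc : ∀ g : G, n1 * g = g * n1) (hsq : n1 * n1 = 1) (μ : Fin P.d) (U : GaugeField P j G) :
    ∀ (x : Site P j) (w : List (Letter P.d)),
      holT (fun b : PBond P j => (if b.dir = μ ∧ (b.src μ).val + 1 = P.sitesPerDir j then n1 else 1) * U b) x w =
        n1 ^ ((walk x w).countP fun s => decide (s.bond.dir = μ ∧ (s.bond.src μ).val + 1 = P.sitesPerDir j)) * holT U x w
  | x, [] => by simp [holT_nil, walk]
  | x, (ν, true) :: w => by
    rw [holT_cons_true, holT_cons_true, holT_seamTwist_count n1 hc hsq μ U (x.shift ν) w]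
    rw [show walk x ((ν, true) :: w) = ⟨⟨x, ν⟩, true⟩ :: walk (x.shift ν) w from rfl, List.countP_cons]
    dsimp only
    by_cases hχ : (ν = μ ∧ (x μ).val + 1 = P.sitesPerDir j)
    · obtain ⟨rfl, h2⟩ := hχ
      simp only [h2, and_self, ↓reduceIte, decide_true, pow_succ, mul_assoc]
      rw [← mul_assoc (U _), ← pow_mul_comm n1 hc _ (U _), mul_assoc, ← mul_assoc n1, ← pow_mul_comm n1 hc _ n1, mul_assoc]
    · simp only [hχ, ↓reduceIte, decide_false, Bool.false_eq_true, add_zero, one_mul]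
      rw [← mul_assoc, ← pow_mul_comm n1 hc, mul_assoc]
  | x, (ν, false) :: w => by
    rw [holT_cons_false, holT_cons_false, holT_seamTwist_count n1 hc hsq μ U (x.unshift ν) w]
    rw [show walk x ((ν, false) :: w) = ⟨⟨x.unshift ν, ν⟩, false⟩ :: walk (x.unshift ν) w from rfl, List.countP_cons]
    dsimp only
    by_cases hχ : (ν = μ ∧ ((x.unshift ν) μ).val + 1 = P.sitesPerDir j)
    · obtain ⟨rfl, h2⟩ := hχ
      simp only [h2, and_self, ↓reduceIte, decide_true, pow_succ, mul_assoc, mul_inv_rev, inv_eq_self_of_sq n1 hsq]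
      rw [← mul_assoc ((U _)⁻¹) n1, ← hc ((U _)⁻¹), mul_assoc, ← mul_assoc ((U _)⁻¹), ← pow_mul_comm n1 hc _ ((U _)⁻¹), mul_assoc,
        ← mul_assoc n1, ← pow_mul_comm n1 hc _ n1, mul_assoc]
    · simp only [hχ, ↓reduceIte, decide_false, Bool.false_eq_true, add_zero, one_mul]
      rw [← mul_assoc, ← pow_mul_comm n1 hc, mul_assoc]

/-- The value of the `μ`-coordinate after one forward step. [folklore] -/
theorem val_shift_self (x : Site P j) (μ : Fin P.d) :
    ((x.shift μ) μ).val = if (x μ).val + 1 = P.sitesPerDir j then 0 else (x μ).val + 1 := by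
  have hN : P.sitesPerDir j ≠ 0 := P.sitesPerDir_ne_zero j
  haveI : NeZero (P.sitesPerDir j) := ⟨hN⟩
  have h1 : (x.shift μ) μ = x μ + 1 := by simp [Site.shift]
  rw [h1, ZMod.val_add, ZMod.val_one_eq_one_mod]
  have hlt : (x μ).val < P.sitesPerDir j := ZMod.val_lt _
  by_cases h : (x μ).val + 1 = P.sitesPerDir j
  · rw [if_pos h]
    have h2 : 2 ≤ P.sitesPerDir j := by
      unfold Params.sitesPerDir; have := Nat.one_le_pow (P.m + P.K - j) P.L P.L_pos; omega
    rw [Nat.mod_eq_of_lt (by omega : 1 < P.sitesPerDir j), h, Nat.mod_self]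
  · rw [if_neg h]
    have h2 : 2 ≤ P.sitesPerDir j := by
      unfold Params.sitesPerDir; have := Nat.one_le_pow (P.m + P.K - j) P.L P.L_pos; omega
    rw [Nat.mod_eq_of_lt (by omega : 1 < P.sitesPerDir j), Nat.mod_eq_of_lt (by omega)]

/-- The value of the `μ`-coordinate after one backward step. [folklore] -/
theorem val_unshift_self (x : Site P j) (μ : Fin P.d) :
    ((x.unshift μ) μ).val = if (x μ).val = 0 then P.sitesPerDir j - 1 else (x μ).val - 1 := by
  have hN : P.sitesPerDir j ≠ 0 := P.sitesPerDir_ne_zero j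
  haveI : NeZero (P.sitesPerDir j) := ⟨hN⟩
  have h1 : (x.unshift μ) μ = x μ - 1 := by simp [Site.unshift]
  have hback : ((x.unshift μ).shift μ) μ = x μ := by simp [Site.shift, Site.unshift]
  have hvs := val_shift_self (x.unshift μ) μ
  rw [hback] at hvs
  have hlt : ((x.unshift μ) μ).val < P.sitesPerDir j := ZMod.val_lt _
  by_cases h : ((x.unshift μ) μ).val + 1 = P.sitesPerDir j
  · rw [if_pos h] at hvs
    rw [if_pos hvs]
    omega
  · rw [if_neg h] at hvs
    rw [if_neg (by omega)]
    omega

/-- Other coordinates do not move under a step in direction `μ`. [folklore] -/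
theorem shift_apply_of_ne (x : Site P j) {μ ν : Fin P.d} (h : ν ≠ μ) : (x.shift μ) ν = x ν := by
  simp [Site.shift, h]

/-- Other coordinates do not move under a backward step in direction `μ`. [folklore] -/
theorem unshift_apply_of_ne (x : Site P j) {μ ν : Fin P.d} (h : ν ≠ μ) : (x.unshift μ) ν = x ν := by
  simp [Site.unshift, h]

/-- ★ **THE SEAM-CROSSING IDENTITY**: along the walk of `w` from `x`, `N · (#forward − #backward crossings of the seam `x_μ = N − 1`) =
netDisp_μ(w) − (x_μ(end) − x_μ(start))` (values in `{0,…,N−1}`). [folklore] -/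
theorem seam_crossing_identity (μ : Fin P.d) :
    ∀ (x : Site P j) (w : List (Letter P.d)),
      (P.sitesPerDir j : ℤ) *
          ((((walk x w).countP fun s => s.fwd && decide (s.bond.dir = μ ∧ (s.bond.src μ).val + 1 = P.sitesPerDir j)) : ℤ) -
            (((walk x w).countP fun s => !s.fwd && decide (s.bond.dir = μ ∧ (s.bond.src μ).val + 1 = P.sitesPerDir j)) : ℤ)) =
        netDisp w μ - ((((walkEnd x w) μ).val : ℤ) - ((x μ).val : ℤ))
  | x, [] => by simp [walk, walkEnd, netDisp]
  | x, (ν, true) :: w => by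
    have ih := seam_crossing_identity μ (x.shift ν) w
    rw [show walk x ((ν, true) :: w) = ⟨⟨x, ν⟩, true⟩ :: walk (x.shift ν) w from rfl,
      show walkEnd x ((ν, true) :: w) = walkEnd (x.shift ν) w from rfl, List.countP_cons, List.countP_cons, netDisp_cons]
    dsimp only
    simp only [Bool.true_and, decide_eq_true_eq, Bool.not_true, Bool.false_and, Bool.false_eq_true, ↓reduceIte, add_zero]
    by_cases hν : ν = μ
    · subst hν
      have hvs := val_shift_self x ν
      have hxlt : (x ν).val < P.sitesPerDir j := ZMod.val_lt _
      by_cases hwrap : (x ν).val + 1 = P.sitesPerDir j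
      · rw [if_pos hwrap] at hvs
        rw [if_pos ⟨rfl, hwrap⟩, if_pos rfl]
        rw [hvs] at ih
        have hw' : ((x ν).val : ℤ) = (P.sitesPerDir j : ℤ) - 1 := by
          have := congrArg (fun n : ℕ => (n : ℤ)) hwrap; push_cast at this; linarith
        push_cast at ih ⊢
        linarith
      · rw [if_neg hwrap] at hvs
        rw [if_neg (fun h => hwrap h.2), if_pos rfl]
        rw [hvs] at ih
        push_cast at ih ⊢
        linarith
    · have hx : (x.shift ν) μ = x μ := shift_apply_of_ne x (fun h => hν h.symm)
      rw [if_neg (fun h => hν h.1), if_neg hν]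
      rw [hx] at ih
      push_cast at ih ⊢
      linarith
  | x, (ν, false) :: w => by
    have ih := seam_crossing_identity μ (x.unshift ν) w
    rw [show walk x ((ν, false) :: w) = ⟨⟨x.unshift ν, ν⟩, false⟩ :: walk (x.unshift ν) w from rfl,
      show walkEnd x ((ν, false) :: w) = walkEnd (x.unshift ν) w from rfl, List.countP_cons, List.countP_cons, netDisp_cons]
    dsimp only
    simp only [Bool.false_and, Bool.false_eq_true, Bool.not_false, Bool.true_and, decide_eq_true_eq, ↓reduceIte, add_zero]
    by_cases hν : ν = μ
    · subst hν
      have hvu := val_unshift_self x ν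
      have hxlt : (x ν).val < P.sitesPerDir j := ZMod.val_lt _
      have h1N : 1 ≤ P.sitesPerDir j := Nat.one_le_iff_ne_zero.mpr (P.sitesPerDir_ne_zero j)
      by_cases hwrap : (x ν).val = 0
      · rw [if_pos hwrap] at hvu
        have hcross : (x.unshift ν ν).val + 1 = P.sitesPerDir j := by omega
        rw [if_pos ⟨rfl, hcross⟩, if_pos rfl]
        have hvu' : (((x.unshift ν ν).val : ℕ) : ℤ) = (P.sitesPerDir j : ℤ) - 1 := by
          rw [hvu]; push_cast [Nat.cast_sub h1N]; ring
        have hx0 : (((x ν).val : ℕ) : ℤ) = 0 := by exact_mod_cast hwrap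
        rw [hvu'] at ih
        rw [hx0]
        push_cast at ih ⊢
        linarith
      · rw [if_neg hwrap] at hvu
        have hncross : ¬ ((x.unshift ν ν).val + 1 = P.sitesPerDir j) := by omega
        rw [if_neg (fun h => hncross h.2), if_pos rfl]
        have h1 : 1 ≤ (x ν).val := Nat.one_le_iff_ne_zero.mpr hwrap
        have hvu' : (((x.unshift ν ν).val : ℕ) : ℤ) = ((x ν).val : ℤ) - 1 := by
          rw [hvu]; push_cast [Nat.cast_sub h1]; ring
        rw [hvu'] at ih
        push_cast at ih ⊢
        linarith
    · have hx : (x.unshift ν) μ = x μ := unshift_apply_of_ne x (fun h => hν h.symm)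
      rw [if_neg (fun h => hν h.1), if_neg hν]
      rw [hx] at ih
      push_cast at ih ⊢
      linarith

/-- Counting the steps on seam bonds by orientation. [folklore] -/
theorem countP_seam_eq_fwd_add_bwd (μ : Fin P.d) (l : List (LStep P j)) :
    (l.countP fun s => decide (s.bond.dir = μ ∧ (s.bond.src μ).val + 1 = P.sitesPerDir j)) =
      (l.countP fun s => s.fwd && decide (s.bond.dir = μ ∧ (s.bond.src μ).val + 1 = P.sitesPerDir j)) +
        (l.countP fun s => !s.fwd && decide (s.bond.dir = μ ∧ (s.bond.src μ).val + 1 = P.sitesPerDir j)) := by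
  induction l with
  | nil => simp
  | cons s l ih =>
    simp only [List.countP_cons, ih]
    cases hs : s.fwd <;>
      by_cases hχ : (s.bond.dir = μ ∧ (s.bond.src μ).val + 1 = P.sitesPerDir j) <;> simp [hχ] <;> omega

/-- ★ **ALONG A CLOSED WORD OF ZERO NET `μ`-DISPLACEMENT THE SEAM IS CROSSED AN EVEN NUMBER OF TIMES, so the seam-twisted transport equals the
untwisted one.** [cite: Balaban1985Averaging, (9) p.19] -/
theorem holT_seamTwist_of_closed (n1 : G) (hc : ∀ g : G, n1 * g = g * n1) (hsq : n1 * n1 = 1) (μ : Fin P.d) (U : GaugeField P j G)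
    (x : Site P j) {w : List (Letter P.d)} (hclosed : walkEnd x w = x) (hw : netDisp w μ = 0) :
    holT (fun b : PBond P j => (if b.dir = μ ∧ (b.src μ).val + 1 = P.sitesPerDir j then n1 else 1) * U b) x w = holT U x w := by
  rw [holT_seamTwist_count n1 hc hsq μ U x w]
  have hid := seam_crossing_identity (P := P) (j := j) μ x w
  rw [hclosed, hw, sub_self, sub_self, mul_eq_zero] at hid
  have hN : (P.sitesPerDir j : ℤ) ≠ 0 := by exact_mod_cast P.sitesPerDir_ne_zero j
  have hFB := (hid.resolve_left hN)
  rw [countP_seam_eq_fwd_add_bwd]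
  set F := (walk x w).countP fun s => s.fwd && decide (s.bond.dir = μ ∧ (s.bond.src μ).val + 1 = P.sitesPerDir j)
  set B := (walk x w).countP fun s => !s.fwd && decide (s.bond.dir = μ ∧ (s.bond.src μ).val + 1 = P.sitesPerDir j)
  have hFBn : F = B := by exact_mod_cast sub_eq_zero.mp hFB
  rw [hFBn, ← two_mul, pow_two_mul_eq_one n1 hsq, one_mul]

/-- **THE LOOP VARIABLES OF (0.4) ARE SEAM-TWIST-INVARIANT** (closed: ✓`walkEnd_eq_self_of_netDisp`; zero net displacement: ✓`netDisp_loopWord`).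
[cite: Balaban1987RG1, (0.4) p.253] -/
theorem loopHol_seamTwist (n1 : G) (hc : ∀ g : G, n1 * g = g * n1) (hsq : n1 * n1 = 1) (μ : Fin P.d) (U : GaugeField P j G) (c : PBond P (j+1)) :
    loopHol (fun b : PBond P j => (if b.dir = μ ∧ (b.src μ).val + 1 = P.sitesPerDir j then n1 else 1) * U b) c = loopHol U c := by
  funext i
  unfold loopHol
  rw [← holT_eq_holAt, ← holT_eq_holAt]
  refine holT_seamTwist_of_closed n1 hc hsq μ U _ (walkEnd_eq_self_of_netDisp fun ν => ?_) (netDisp_loopWord _ _ _ _ _ μ)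
  rw [netDisp_loopWord, Int.cast_zero]

/-- Hence the guard and **THE CORRECTION FACTOR OF RECORD ARE SEAM-TWIST-INVARIANT**. [cite: Balaban1987RG1, (0.4) p.253] -/
theorem corr_seamTwist (ℰ : LoopAverage G) (n1 : G) (hc : ∀ g : G, n1 * g = g * n1) (hsq : n1 * n1 = 1) (μ : Fin P.d) (U : GaugeField P j G)
    (c : PBond P (j+1)) :
    corr ℰ (fun b : PBond P j => (if b.dir = μ ∧ (b.src μ).val + 1 = P.sitesPerDir j then n1 else 1) * U b) c = corr ℰ U c := by
  classical
  unfold corr BlockAveraging.Small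
  rw [loopHol_seamTwist n1 hc hsq μ U c]

end Words

end Summit.QuantumFields.YangMills.Theorems.FluctuationComparisonRegPrIntLS2BetaSeamTwistWords

end
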